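import Summits.Ventures.YMGap.RobustBall.TorusDoorSUN
import Summits.Ventures.YMGap.YM3IR.BallInstance
import HarnessLib

/-!
# Venture YMGap, track Y2 ROBUST-BALL — the ALL-`N` TORUS ROWS (hypothesis-free, every `N ≥ 2`, radii UNIFORM in
# `N`): `d = 4` and `d = 3` tier 1 / tier 2, and Y4's receiving predicate `YM3IR.ClusterDomainClustering` on the named
# ball specs `YM3IR.ballOfRobustBallFR` / `YM3IR.ballOfRobustBall` for every `SU(N)`, `d = 3`

HONEST FRAMING.  Venture file of the cell `pub-ymgap` (QuantumFields programme), track ROBUST-BALL, seat p1 (g7).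
Strong-coupling LATTICE statements only: `SU(N)` lattice Yang–Mills on finite tori `(ℤ/L)^d`, `L ≥ 3`, at 't Hooft
coupling `t` — TREE coupling `β = N t` (the Wilson-part coupling of `W.perturbedMeasure (fundamentalRep (Fin N)) β`),
`SU(2)` Wilson `β_W = 4t` — plus a link perturbation in the cell's typed balls.  Nothing about the continuum, weak
coupling, a transfer-matrix spectral gap, or the Clay problem.  Each row is ONE `norm_num` evaluation of the rational
certificate of the schemas in `TorusDoorSUN` (Taylor majorant `T₆ ≥ exp` on `[0,1]`, a rational `s ≥ 1/√(2(1/2 − b))`, a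
rational ceiling `ρ'` of the `N = 2` row value, which dominates every `N ≥ 2`); no certificate file, no named hypothesis.

ROWS (ceiling `β⋆ = N t` in TREE units; one-parameter radii `(ε₀, ε₁) = (2ε, ε)` with `ε` maximal at `1/1000` in the
seat's float screen — next step `> 1` —, plus p2's `(1/10, 1/10)` cell of `RowsSUN`; every `N ≥ 2`; constant `8N`, rate
`m = −log ρ'/(r ⊔ 1) > 0`, independent of `N`):
* `d = 4`, tier 1 up to `β⋆ = N t`: `(t, ε) = (1/64, .110)` ρ' = .9989 · `(1/64; 1/10, 1/10)` ρ' = .8818 · `(1/96, .233)` ρ' = .9975;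
* `d = 4`, tier 2 (`κ = log 6/5`, every `|β| ≤ N/96`): `(1/96, log 6/5, .190)`, rate `log 6/5`;
* `d = 3`, tier 1: `(1/40, .087)` ρ' = .9987 · `(1/48, .149)` ρ' = .9978 · `(1/64, .233)` ρ' = .9975; tier 2 `(1/64, log 6/5, .190)`;
* `d = 3`, Y4's receiving predicate in ym3ir-theory-1's shape (bus 2026-08-23T00:53:36Z), for every `SU(N)`, `N ≥ 2`:
  `YM3IR.ClusterDomainClustering (YM3IR.ballOfRobustBallFR N (2ε) ε r (N t)) suFrobDist m` at the three tier-1 cells and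
  `YM3IR.ClusterDomainClustering (YM3IR.ballOfRobustBall N (log 6/5) (19/50) (19/100) (N/64)) suFrobDist (log 6/5)` —
  the `hRB` slot of `YM3IR.BalabanSUN.massGap3Cofinal_suN_balaban_of_irConjecture3`, hypothesis-free for every `N`.
In `SU(2)` Wilson units these cells sit at `β_W ≤ 1/10`; for `N = 2, 3` the certified files (`TorusRowsSU2*`,
`TorusRowsYM3`, `TorusRowsSU3*`) are sharper — the point here is the every-`N` line with ONE radius pair for all `N`.
Screen and exact certificate values: p1-g7 session folder `work/screen.py`, `work/cert.py`.
-/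

noncomputable section

open MeasureTheory ProbabilityTheory Finset Function Real
open Literature.Probability.LatticeModels Literature.Probability.LatticeModels.DobrushinMetric
open Literature.MathematicalPhysics.QuantumLattice hiding torusNorm
open Literature.MathematicalPhysics.QuantumFieldTheory hiding ZdEdge
open Summit.Ventures.YMGap.RobustBall

namespace Summit.Ventures.YMGap.RobustBallSUN

variable {N : ℕ}

/-! ### 0. Rates -/

/-- The rate attached to a ceiling `0 < ρ' < 1` is positive. [folklore] -/
theorem rate_pos_of_ceiling {ρ' : ℝ} (hρ'0 : 0 < ρ') (hρ'1 : ρ' < 1) (r : ℕ) :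
    0 < -Real.log ρ' / max (r : ℝ) 1 :=
  div_pos (neg_pos.2 (Real.log_neg hρ'0 hρ'1)) (lt_max_of_lt_right one_pos)

/-- The rates of the rows below are positive (Y4's `hm : 0 < m_c` slot). [folklore] -/
theorem suN_rows_rate_pos (r : ℕ) :
    0 < -Real.log (9989 / 10000) / max (r : ℝ) 1 ∧ 0 < -Real.log (4409 / 5000) / max (r : ℝ) 1 ∧
      0 < -Real.log (399 / 400) / max (r : ℝ) 1 ∧ 0 < -Real.log (9987 / 10000) / max (r : ℝ) 1 ∧
        0 < -Real.log (4989 / 5000) / max (r : ℝ) 1 ∧ 0 < Real.log (6 / 5) :=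
  ⟨rate_pos_of_ceiling (by norm_num) (by norm_num) r, rate_pos_of_ceiling (by norm_num) (by norm_num) r,
    rate_pos_of_ceiling (by norm_num) (by norm_num) r, rate_pos_of_ceiling (by norm_num) (by norm_num) r,
    rate_pos_of_ceiling (by norm_num) (by norm_num) r, Real.log_pos (by norm_num)⟩

/-! ### 1. `d = 4` rows, every `N ≥ 2` -/

/-- **ROW `d = 4`, every `N ≥ 2`: `(t, ε₀, ε₁) = (1/64, 11/50, 11/100)`** (one-parameter `ε = 0.110`; tree ceiling
`β⋆ = N/64`, `SU(2)` Wilson `β_W = 1/16`), ceiling `ρ' = 0.9989`: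
`TorusClusteringOnBallUpTo N 4 (N/64) (11/50) (11/100) r (8N) (−log 0.9989/(r ⊔ 1))`.  Hypothesis-free. [folklore] -/
theorem suN_torusRow4_1_64 (hN : 2 ≤ N) (r : ℕ) :
    TorusClusteringOnBallUpTo N 4 ((N : ℝ) / 64) (11 / 50) (11 / 100) r (8 * N)
      (-Real.log (9989 / 10000) / max r 1) := by
  have h := suN_torusClusteringOnBallUpTo_of_cert (d := 4) (by norm_num) hN (t := 1 / 64) (ε₀ := 11 / 50)
    (ε₁ := 11 / 100) (s := 2773501 / 2500000) (ρ' := 9989 / 10000) (by norm_num) (by norm_num) (by norm_num)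
    (by norm_num) (by norm_num) (by norm_num) (by norm_num) r (by norm_num) (by norm_num) (by norm_num)
  rw [mul_one_div] at h
  exact h

/-- **ROW `d = 4`, every `N ≥ 2`: `(t, ε₀, ε₁) = (1/64, 1/10, 1/10)`** — p2's `RowsSUN` cell in the torus currency
(row value `≤ 0.8818`): `TorusClusteringOnBallUpTo N 4 (N/64) (1/10) (1/10) r (8N) (−log 0.8818/(r ⊔ 1))`. [folklore] -/
theorem suN_torusRow4_1_64_tenth (hN : 2 ≤ N) (r : ℕ) :
    TorusClusteringOnBallUpTo N 4 ((N : ℝ) / 64) (1 / 10) (1 / 10) r (8 * N)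
      (-Real.log (4409 / 5000) / max r 1) := by
  have h := suN_torusClusteringOnBallUpTo_of_cert (d := 4) (by norm_num) hN (t := 1 / 64) (ε₀ := 1 / 10)
    (ε₁ := 1 / 10) (s := 2773501 / 2500000) (ρ' := 4409 / 5000) (by norm_num) (by norm_num) (by norm_num)
    (by norm_num) (by norm_num) (by norm_num) (by norm_num) r (by norm_num) (by norm_num) (by norm_num)
  rw [mul_one_div] at h
  exact h

/-- **ROW `d = 4`, every `N ≥ 2`: `(t, ε₀, ε₁) = (1/96, 233/500, 233/1000)`** (`ε = 0.233`; tree ceiling `N/96`,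
`SU(2)` Wilson `β_W = 1/24`), ceiling `ρ' = 0.9975`. [folklore] -/
theorem suN_torusRow4_1_96 (hN : 2 ≤ N) (r : ℕ) :
    TorusClusteringOnBallUpTo N 4 ((N : ℝ) / 96) (233 / 500) (233 / 1000) r (8 * N)
      (-Real.log (399 / 400) / max r 1) := by
  have h := suN_torusClusteringOnBallUpTo_of_cert (d := 4) (by norm_num) hN (t := 1 / 96) (ε₀ := 233 / 500)
    (ε₁ := 233 / 1000) (s := 213809 / 200000) (ρ' := 399 / 400) (by norm_num) (by norm_num) (by norm_num)
    (by norm_num) (by norm_num) (by norm_num) (by norm_num) r (by norm_num) (by norm_num) (by norm_num)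
  rw [mul_one_div] at h
  exact h

/-- **TIER-2 ROW `d = 4`, every `N ≥ 2`: `(t, κ, ε₀, ε₁) = (1/96, log 6/5, 19/50, 19/100)`** (`ε = 0.190`), at every
tree coupling `|β| ≤ N/96`: `TorusClusteringOnBallW N 4 β (log 6/5) (19/50) (19/100) (8N) (log 6/5)` — rate `log 6/5` per
lattice unit on the diameter-weighted ball. [folklore] -/
theorem suN_torusRowW4_1_96 (hN : 2 ≤ N) {β : ℝ} (hβ : |β| / N ≤ 1 / 96) :
    TorusClusteringOnBallW N 4 β (Real.log (6 / 5)) (19 / 50) (19 / 100) (8 * N) (Real.log (6 / 5)) :=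
  suN_torusClusteringOnBallW_of_cert (d := 4) (by norm_num) hN (w := 6 / 5) (t := 1 / 96) (ε₀ := 19 / 50)
    (ε₁ := 19 / 100) (s := 213809 / 200000) (ρ' := 9977 / 10000) (by norm_num) hβ (by norm_num) (by norm_num)
    (by norm_num) (by norm_num) (by norm_num) (by norm_num) (by norm_num) (by norm_num)

/-! ### 2. `d = 3` rows, every `N ≥ 2` (torus currency) -/

/-- **ROW `d = 3`, every `N ≥ 2`: `(t, ε₀, ε₁) = (1/40, 87/500, 87/1000)`** (`ε = 0.087`; tree ceiling `N/40`, `SU(2)`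
Wilson `β_W = 1/10`), ceiling `0.9987`: `TorusClusteringOnBallUpTo N 3 (N/40) (87/500) (87/1000) r (8N) (−log 0.9987/(r ⊔ 1))`.
[folklore] -/
theorem suN_torusRow3_1_40 (hN : 2 ≤ N) (r : ℕ) :
    TorusClusteringOnBallUpTo N 3 ((N : ℝ) / 40) (87 / 500) (87 / 1000) r (8 * N)
      (-Real.log (9987 / 10000) / max r 1) := by
  have h := suN_torusClusteringOnBallUpTo_of_cert (d := 3) (by norm_num) hN (t := 1 / 40) (ε₀ := 87 / 500)
    (ε₁ := 87 / 1000) (s := 559017 / 500000) (ρ' := 9987 / 10000) (by norm_num) (by norm_num) (by norm_num)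
    (by norm_num) (by norm_num) (by norm_num) (by norm_num) r (by norm_num) (by norm_num) (by norm_num)
  rw [mul_one_div] at h
  exact h

/-- **ROW `d = 3`, every `N ≥ 2`: `(t, ε₀, ε₁) = (1/48, 149/500, 149/1000)`** (`ε = 0.149`; tree ceiling `N/48`, `SU(2)`
Wilson `β_W = 1/12`), ceiling `0.9978`. [folklore] -/
theorem suN_torusRow3_1_48 (hN : 2 ≤ N) (r : ℕ) :
    TorusClusteringOnBallUpTo N 3 ((N : ℝ) / 48) (149 / 500) (149 / 1000) r (8 * N)
      (-Real.log (4989 / 5000) / max r 1) := by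
  have h := suN_torusClusteringOnBallUpTo_of_cert (d := 3) (by norm_num) hN (t := 1 / 48) (ε₀ := 149 / 500)
    (ε₁ := 149 / 1000) (s := 2738613 / 2500000) (ρ' := 4989 / 5000) (by norm_num) (by norm_num) (by norm_num)
    (by norm_num) (by norm_num) (by norm_num) (by norm_num) r (by norm_num) (by norm_num) (by norm_num)
  rw [mul_one_div] at h
  exact h

/-- **ROW `d = 3`, every `N ≥ 2`: `(t, ε₀, ε₁) = (1/64, 233/500, 233/1000)`** (`ε = 0.233`; tree ceiling `N/64`, `SU(2)`
Wilson `β_W = 1/16`), ceiling `0.9975`. [folklore] -/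
theorem suN_torusRow3_1_64 (hN : 2 ≤ N) (r : ℕ) :
    TorusClusteringOnBallUpTo N 3 ((N : ℝ) / 64) (233 / 500) (233 / 1000) r (8 * N)
      (-Real.log (399 / 400) / max r 1) := by
  have h := suN_torusClusteringOnBallUpTo_of_cert (d := 3) (by norm_num) hN (t := 1 / 64) (ε₀ := 233 / 500)
    (ε₁ := 233 / 1000) (s := 213809 / 200000) (ρ' := 399 / 400) (by norm_num) (by norm_num) (by norm_num)
    (by norm_num) (by norm_num) (by norm_num) (by norm_num) r (by norm_num) (by norm_num) (by norm_num)
  rw [mul_one_div] at h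
  exact h

/-- **TIER-2 ROW `d = 3`, every `N ≥ 2`: `(t, κ, ε₀, ε₁) = (1/64, log 6/5, 19/50, 19/100)`** (`ε = 0.190`), at every
tree coupling `|β| ≤ N/64`: `TorusClusteringOnBallW N 3 β (log 6/5) (19/50) (19/100) (8N) (log 6/5)`. [folklore] -/
theorem suN_torusRowW3_1_64 (hN : 2 ≤ N) {β : ℝ} (hβ : |β| / N ≤ 1 / 64) :
    TorusClusteringOnBallW N 3 β (Real.log (6 / 5)) (19 / 50) (19 / 100) (8 * N) (Real.log (6 / 5)) :=
  suN_torusClusteringOnBallW_of_cert (d := 3) (by norm_num) hN (w := 6 / 5) (t := 1 / 64) (ε₀ := 19 / 50)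
    (ε₁ := 19 / 100) (s := 213809 / 200000) (ρ' := 9977 / 10000) (by norm_num) hβ (by norm_num) (by norm_num)
    (by norm_num) (by norm_num) (by norm_num) (by norm_num) (by norm_num) (by norm_num)

/-! ### 3. Y4's receiving predicate on the named ball specs, every `SU(N)`, `d = 3` (ym3ir-theory-1's shape) -/

/-- **Y4 ROW, every `SU(N)`, `N ≥ 2`, tier 1: `(t, ε₀, ε₁) = (1/40, 87/500, 87/1000)`** — the `hRB` slot of
`YM3IR.BalabanSUN.massGap3Cofinal_suN_balaban_of_irConjecture3` INHABITED HYPOTHESIS-FREE: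
`ClusterDomainClustering (ballOfRobustBallFR N (87/500) (87/1000) r (N/40)) suFrobDist (−log 0.9987/(r ⊔ 1))` (tree ceiling
`β⋆ = N/40`, i.e. 't Hooft `1/40`; rate `> 0` by `suN_rows_rate_pos`). [folklore] -/
theorem suN_clusterDomainClustering_dim3_1_40 (N : ℕ) (hN : 2 ≤ N) (r : ℕ) :
    YM3IR.ClusterDomainClustering (YM3IR.ballOfRobustBallFR N (87 / 500) (87 / 1000) r ((N : ℝ) / 40)) suFrobDist
      (-Real.log (9987 / 10000) / max r 1) :=
  YM3IR.clusterDomainClustering_of_torusClusteringOnBallUpTo (suN_torusRow3_1_40 hN r)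

/-- **Y4 ROW, every `SU(N)`, `N ≥ 2`, tier 1: `(t, ε₀, ε₁) = (1/48, 149/500, 149/1000)`**:
`ClusterDomainClustering (ballOfRobustBallFR N (149/500) (149/1000) r (N/48)) suFrobDist (−log 0.9978/(r ⊔ 1))`.
Hypothesis-free. [folklore] -/
theorem suN_clusterDomainClustering_dim3_1_48 (N : ℕ) (hN : 2 ≤ N) (r : ℕ) :
    YM3IR.ClusterDomainClustering (YM3IR.ballOfRobustBallFR N (149 / 500) (149 / 1000) r ((N : ℝ) / 48)) suFrobDist
      (-Real.log (4989 / 5000) / max r 1) :=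
  YM3IR.clusterDomainClustering_of_torusClusteringOnBallUpTo (suN_torusRow3_1_48 hN r)

/-- **Y4 ROW, every `SU(N)`, `N ≥ 2`, tier 1: `(t, ε₀, ε₁) = (1/64, 233/500, 233/1000)`**:
`ClusterDomainClustering (ballOfRobustBallFR N (233/500) (233/1000) r (N/64)) suFrobDist (−log 0.9975/(r ⊔ 1))`.
Hypothesis-free. [folklore] -/
theorem suN_clusterDomainClustering_dim3_1_64 (N : ℕ) (hN : 2 ≤ N) (r : ℕ) :
    YM3IR.ClusterDomainClustering (YM3IR.ballOfRobustBallFR N (233 / 500) (233 / 1000) r ((N : ℝ) / 64)) suFrobDist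
      (-Real.log (399 / 400) / max r 1) :=
  YM3IR.clusterDomainClustering_of_torusClusteringOnBallUpTo (suN_torusRow3_1_64 hN r)

/-- **Y4 ROW, every `SU(N)`, `N ≥ 2`, tier 2 (the diameter-weighted ball Y4 hands over):
`(t, κ, ε₀, ε₁) = (1/64, log 6/5, 19/50, 19/100)`**:
`ClusterDomainClustering (ballOfRobustBall N (log 6/5) (19/50) (19/100) (N/64)) suFrobDist (log 6/5)` — rate `log 6/5 > 0`,
tree ceiling `β⋆ = N/64 > 0`.  Hypothesis-free. [folklore] -/
theorem suN_clusterDomainClusteringW_dim3_1_64 (N : ℕ) (hN : 2 ≤ N) :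
    YM3IR.ClusterDomainClustering (YM3IR.ballOfRobustBall N (Real.log (6 / 5)) (19 / 50) (19 / 100) ((N : ℝ) / 64))
      suFrobDist (Real.log (6 / 5)) := by
  refine YM3IR.clusterDomainClustering_of_torusClusteringOnBallW (A := 8 * N) fun β hβ0 hββs => ?_
  have hN0 : (0 : ℝ) < N := by exact_mod_cast (show 0 < N by omega)
  have hβt : |β| / N ≤ 1 / 64 := by
    rw [abs_of_nonneg hβ0, div_le_iff₀ hN0]
    linarith
  exact suN_torusRowW3_1_64 hN hβt

/-- The same tier-2 Y4 row in ds-2's anonymous-constructor shape (definitionally the named ball spec):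
`ClusterDomainClustering ⟨fundamental SU(N), N/64, membership in ClusterDomain (log 6/5) (19/50) (19/100)⟩ suFrobDist (log 6/5)`.
[folklore] -/
theorem suN_clusterDomainClusteringW_dim3_1_64' (N : ℕ) (hN : 2 ≤ N) :
    YM3IR.ClusterDomainClustering (G := SUN N)
      ⟨fundamentalRep (Fin N), (N : ℝ) / 64, fun _ _ W => W ∈ ClusterDomain (Real.log (6 / 5)) (19 / 50) (19 / 100)⟩
      suFrobDist (Real.log (6 / 5)) :=
  suN_clusterDomainClusteringW_dim3_1_64 N hN

/-! ### 4. The rates in the rows' cast form (appended; Y4's `hm` slot verbatim) -/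

/-- The rate attached to a ceiling `0 < ρ' < 1`, in the form the rows print it (`↑(max r 1)`, a natural-number maximum
cast to `ℝ`). [folklore] -/
theorem rate_pos_of_ceiling' {ρ' : ℝ} (hρ'0 : 0 < ρ') (hρ'1 : ρ' < 1) (r : ℕ) :
    0 < -Real.log ρ' / ((max r 1 : ℕ) : ℝ) :=
  div_pos (neg_pos.2 (Real.log_neg hρ'0 hρ'1)) (by exact_mod_cast (lt_max_of_lt_right one_pos))

/-- **The rates of the rows above, in the rows' own cast form** — the `hm : 0 < m_c` slot of
`YM3IR.BalabanSUN.massGap3Cofinal_suN_balaban_of_irConjecture3` for the three tier-1 Y4 rows, so that e.g.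
`massGap3Cofinal_suN_balaban_of_irConjecture3 hfam hC hκ (suN_rows_rate_pos' r).2.2.1 hUV
(suN_clusterDomainClustering_dim3_1_48 N hN r) hIR` typechecks for every `N ≥ 2`: ceilings `9987/10000` (row `1/40`),
`4989/5000` (row `1/48`), `399/400` (rows `1/64` and `d = 4` `1/96`), `9989/10000`, `4409/5000` (`d = 4` rows `1/64`). [folklore] -/
theorem suN_rows_rate_pos' (r : ℕ) :
    0 < -Real.log (9987 / 10000) / ((max r 1 : ℕ) : ℝ) ∧ 0 < -Real.log (4989 / 5000) / ((max r 1 : ℕ) : ℝ) ∧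
      0 < -Real.log (399 / 400) / ((max r 1 : ℕ) : ℝ) ∧ 0 < -Real.log (9989 / 10000) / ((max r 1 : ℕ) : ℝ) ∧
        0 < -Real.log (4409 / 5000) / ((max r 1 : ℕ) : ℝ) :=
  ⟨rate_pos_of_ceiling' (by norm_num) (by norm_num) r, rate_pos_of_ceiling' (by norm_num) (by norm_num) r,
    rate_pos_of_ceiling' (by norm_num) (by norm_num) r, rate_pos_of_ceiling' (by norm_num) (by norm_num) r,
    rate_pos_of_ceiling' (by norm_num) (by norm_num) r⟩

end Summit.Ventures.YMGap.RobustBallSUN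

end
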